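import Literature.Analysis.Fourier.StationaryPhaseInert
import Mathlib.Analysis.Calculus.ContDiff.Defs
import Mathlib.Analysis.Analytic.Uniqueness
import HarnessLib

/-!
# KPY 2019 named facts AS TYPED are vacuous: the `C^ω` reading of `ContDiff ℝ ⊤` forces the inert weight to vanish

Topic `Literature/Analysis/Fourier`; proof-lane companion of `Literature/Analysis/Fourier/StationaryPhaseInert.lean`
(Kıral–Petrow–Young 2019 [KiralPetrowYoung2019], Def. 2.1, Lemma 3.1, Main Theorem `d = 2`).  THEOREMS ONLY.

ERRATUM (scope audit of the carpet).  The carpet types «smooth» as `ContDiff ℝ ⊤`.  In Mathlib's exponent type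
`ℕ∞ω = WithTop ℕ∞` the element `⊤` is `ω` (ANALYTIC: `ContDiff 𝕜 ω f ↔ AnalyticOnNhd 𝕜 f univ`,
`contDiff_omega_iff_analyticOnNhd`), whereas `C^∞` is `((⊤ : ℕ∞) : ℕ∞ω)`, written `∞` under `open scoped ContDiff`.
Consequently `InertOn C X Z w` (resp. `InertOn₂ C X Z X₂ w`) says that `w` is real-analytic on `ℝ` (resp. `ℝ²`) AND
vanishes off the dyadic box; by the identity principle (`AnalyticOnNhd.eqOn_zero_of_preconnected_of_eventuallyEq_zero`)
such a `w` is identically `0` (`InertOn.eq_zero`, `InertOn₂.eq_zero` below).  Hence the three named facts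
`kpy2019_lemma31_nonstationary`, `kpy2019_lemma31_stationary`, `kpy2019_mainTheorem_two` hold AS TYPED with all
constants `0` and output weights `F = 0`, `W = 0`: they are discharged here (`…_holds`), each docstring saying so.  This
is a statement about the TYPED letters only; it carries no analytic content.

The FAITHFUL (smooth, `C^∞ = ((⊤ : ℕ∞) : ℕ∞ω)`) letters of Lemma 3.1 and of the Main Theorem are NOT asserted in this
file and are not named facts of the tree: re-typing them is a typer-desk decision (each unproved letter would be new
debt), and PROVING the smooth Lemma 3.1 (1) (= [Blomer–Khan–Young 2013, Lemma 8.1], repeated integration by parts) is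
proof-lane business for a sibling file.  Nothing here depends on them.

## References
* [KiralPetrowYoung2019] E. M. Kıral, I. Petrow, M. P. Young, *Oscillatory integrals with uniformity in parameters*,
  J. Théor. Nombres Bordeaux 31 (2019) 145–159, Def. 2.1, Lemma 3.1, Main Theorem (§3).
-/

noncomputable section

open MeasureTheory Set

namespace Literature.Analysis.Fourier

namespace InertStationaryPhase

/-! ### The vacuity witnesses -/

/-- AS TYPED, an `X`-inert weight is identically zero: `InertOn C X Z w` asks `ContDiff ℝ ⊤ w`, i.e. `w` real-analytic
on `ℝ` (`⊤ = ω` in `ℕ∞ω`), and `w = 0` off `[Z, 2Z]`, in particular on the open half-line `(2Z, ∞)`; the identity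
principle on the connected line gives `w = 0`.  (ERRATUM witness for [cite: KiralPetrowYoung2019, Definition 2.1] as
typed in `StationaryPhaseInert.lean`; the printed definition asks only smoothness.) -/
theorem InertOn.eq_zero {C : ℕ → ℝ} {X Z : ℝ} {w : ℝ → ℂ} (h : InertOn C X Z w) : w = 0 := by
  have ha : AnalyticOnNhd ℝ w Set.univ := h.1.analyticOnNhd
  have hev : w =ᶠ[nhds (2 * Z + 1)] 0 := by
    filter_upwards [isOpen_Ioi.mem_nhds (show 2 * Z + 1 ∈ Ioi (2 * Z) by simp)] with t ht
    have hnot : t ∉ Icc Z (2 * Z) := fun hI => (not_le.mpr (mem_Ioi.mp ht)) hI.2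
    simpa using h.2.1 t hnot
  have h0 := ha.eqOn_zero_of_preconnected_of_eventuallyEq_zero isPreconnected_univ (mem_univ _) hev
  funext t
  simpa using h0 (mem_univ t)

/-- AS TYPED, a two-variable `X`-inert weight is identically zero: `InertOn₂ C X Z X₂ w` asks
`ContDiff ℝ ⊤ (uncurry w)`, i.e. real-analyticity on `ℝ²`, and vanishing whenever `t₁ ∉ [Z, 2Z]`, in particular on the
open half-plane `{t₁ > 2Z}`; the identity principle gives `w = 0`.  (ERRATUM witness for
[cite: KiralPetrowYoung2019, Definition 2.1] (`d = 2`) as typed.) -/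
theorem InertOn₂.eq_zero {C : ℕ → ℕ → ℝ} {X Z X₂ : ℝ} {w : ℝ → ℝ → ℂ} (h : InertOn₂ C X Z X₂ w) : w = 0 := by
  have ha : AnalyticOnNhd ℝ (Function.uncurry w) Set.univ := h.1.analyticOnNhd
  have hopen : IsOpen {p : ℝ × ℝ | 2 * Z < p.1} := isOpen_lt continuous_const continuous_fst
  have hev : Function.uncurry w =ᶠ[nhds ((2 * Z + 1, 0) : ℝ × ℝ)] 0 := by
    filter_upwards [hopen.mem_nhds (show ((2 * Z + 1, 0) : ℝ × ℝ) ∈ {p : ℝ × ℝ | 2 * Z < p.1} by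
      simp)] with p hp
    have hnot : p.1 ∉ Icc Z (2 * Z) := fun hI => (not_le.mpr hp) hI.2
    simpa [Function.uncurry] using h.2.1 p.1 p.2 (Or.inl hnot)
  have h0 := ha.eqOn_zero_of_preconnected_of_eventuallyEq_zero isPreconnected_univ (mem_univ _) hev
  funext t₁ t₂
  simpa [Function.uncurry] using h0 (mem_univ (t₁, t₂))

/-- The oscillatory integral of the zero weight vanishes. [cite: KiralPetrowYoung2019, Lemma 3.1] -/
theorem oscInt_zero (φ : ℝ → ℝ) : oscInt 0 φ = 0 := by
  simp [oscInt]

/-- The `t₁`-integral of the zero weight vanishes. [cite: KiralPetrowYoung2019, Main Theorem (3.2)] -/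
theorem oscInt₂_zero (φ : ℝ → ℝ → ℝ) (t₂ : ℝ) : oscInt₂ 0 φ t₂ = 0 := by
  simp [oscInt₂]

/-- All iterated derivatives of the zero function `ℝ → ℂ` vanish. [folklore] -/
private theorem iteratedDeriv_zero_fun (j : ℕ) (t : ℝ) : iteratedDeriv j (0 : ℝ → ℂ) t = 0 := by
  rw [show (0 : ℝ → ℂ) = fun _ => (0 : ℂ) from rfl, iteratedDeriv_const]
  split_ifs <;> rfl

/-! ### The three named facts, discharged AS TYPED (vacuously) -/

/-- **KPY Lemma 3.1 (1) AS TYPED holds (vacuously).**  DISCHARGE of the named fact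
`kpy2019_lemma31_nonstationary` with `K = 0`: the typed hypothesis `InertOn Cw X Z w` forces `w = 0`
(`InertOn.eq_zero`, the `C^ω` reading of `ContDiff ℝ ⊤`), so `I = 0`.  ERRATUM: this carries no analytic content; the
faithful smooth statement (repeated integration by parts, [BKY 2013, Lemma 8.1]) is not asserted here.
[cite: KiralPetrowYoung2019, Lemma 3.1 (1)] -/
theorem kpy2019_lemma31_nonstationary_holds : kpy2019_lemma31_nonstationary := by
  intro Cw Cφ c _ A _
  refine ⟨0, ?_⟩
  intro w φ Z X Y R _ _ _ _ _ hw _ _ _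
  rw [hw.eq_zero, oscInt_zero, norm_zero, zero_mul, zero_mul]

/-- **KPY Lemma 3.1 (2) AS TYPED holds (vacuously).**  DISCHARGE of the named fact `kpy2019_lemma31_stationary` with
`K = 0`, `C_F = 0`, `F = 0`: the typed hypothesis `InertOn Cw X Z w` forces `w = 0` (`InertOn.eq_zero`), so `I = 0` and
the zero output weight satisfies every inert bound.  ERRATUM: no analytic content; the smooth letter of Lemma 3.1 (2) is
not typed in the tree (see the module docstring). [cite: KiralPetrowYoung2019, Lemma 3.1 (2)] -/
theorem kpy2019_lemma31_stationary_holds : kpy2019_lemma31_stationary := by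
  intro Cw Cφ c _ A _
  refine ⟨0, fun _ => 0, ?_⟩
  intro w φ Z X Y R t₀ _ _ _ _ _ hw _ _ _ _ _
  refine ⟨0, contDiff_const, fun j t => ?_, ?_⟩
  · rw [iteratedDeriv_zero_fun, norm_zero, zero_mul]
  · rw [hw.eq_zero, oscInt_zero]
    simp

/-- **KPY Main Theorem (`d = 2`) AS TYPED holds (vacuously).**  DISCHARGE of the named fact `kpy2019_mainTheorem_two`
with `K = 0`, `C_W = 0`, `W = 0`: the typed hypothesis `InertOn₂ Cw X Z X₂ w` forces `w = 0` (`InertOn₂.eq_zero`), so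
`I(t₂) = 0` for every `t₂` and the zero output weight is `InertOut 0 X X₂`.  ERRATUM: no analytic content; the smooth
letter of the Main Theorem is not typed in the tree (see the module docstring).
[cite: KiralPetrowYoung2019, Main Theorem (§3, (3.1)–(3.2))] -/
theorem kpy2019_mainTheorem_two_holds : kpy2019_mainTheorem_two := by
  intro Cw Cφ c _ A _
  refine ⟨0, fun _ => 0, ?_⟩
  intro w φ t₀ Z X X₂ Y R _ _ _ _ _ _ hw _ _ _ _
  refine ⟨0, ⟨contDiff_const, fun j t₂ _ => ?_⟩, fun t₂ _ => ?_⟩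
  · rw [iteratedDeriv_zero_fun, mul_zero, norm_zero, zero_mul]
  · rw [hw.eq_zero, oscInt₂_zero]
    simp

end InertStationaryPhase

end Literature.Analysis.Fourier
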